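import Literature.Computability.QuantumComplexity.PseudoBounded
import Literature.Computability.QuantumComplexity.AaronsonAmbainis

/-!
# Route `SosSandwich`, support for `PseudoBoundedAA` (stmt-QuantumAdvantage-15237) — closure of the SOS sandwich
class `K_T` and the Boolean-corner bookkeeping

Tree twin of the cell node `run/shared/lean/pub/decomp-qadv/decomp-qadv-lens-5/g19/CornerDial.lean` §1–§3
(cell `decomp-qadv`, lens 5, gen 19), conjecture-free:

* §1 the cone of sums of squares of total degree `≤ T` as cube functions (`CubeSOS`) is closed under nonnegative
  combinations, PRODUCTS (degrees add) and renaming; `PseudoBounded T p` iff both `p` and `1 - p` lie in it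
  (`pseudoBounded_iff_cubeSOS`); hence `K = ⋃_T K_T` is closed under products (`PseudoBounded.mul/prod`, orders
  add), OR of a family (`orFamily`), convex mixing (`convexComb`), renaming into fresh copies (`rename`),
  Bernstein-positive post-processing (`bernstein`) and 3-majority amplification (`maj₃`) — the classical-control
  operations under which acceptance polynomials of query algorithms are closed, now for `K`.
* §2 `Var[p] = μ(1-μ) − E[p(1−p)]` (`boolVariance_eq_corner`): the variance of a `K_T` member measures its distance
  to the Boolean corner; `Var ≥ 1/4 − η` forces near-Booleanness and near-balance (`nearCorner_of_topBand`);
  `Var ≤ 1/4` (`boolVariance_le_quarter`).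
* §3 the one-bit dictator: `Var = 1/4`, `Inf = 1`.

This is the algebraic half of the variance-saturation bridge of the node (any `p ∈ K_T` with `Var ≥ ε` maps, inside
`K` and at cost `poly(T/ε)`, to a member with `Var ≥ 1/4 − η` whose influences are dominated by `p`'s); step
`r := (Z − EZ)²` of RandomOracleGauge's `VarianceAmplification` (stmt-QuantumAdvantage-17874) is served as well.
[cite: KaniewskiLeeDewolf2015, Def. 7] [cite: KaniewskiLeeDewolf2015, Def. 7, Thm. 12]
-/

set_option linter.dupNamespace false
set_option linter.unusedVariables false

noncomputable section

namespace Summit.QuantumAdvantage.QuantumAdvantage.Theorems.SosSandwich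

open MvPolynomial Finset
open Literature.Computability.QuantumComplexity

/-! ## §1 Cube SOS certificates and the closure properties of `K` -/

variable {N : ℕ}

/-- `g : {0,1}^N → ℝ` is a sum of squares of polynomials of total degree `≤ T` on the cube (the cone `C_T` of
`SosSandwichPseudoBoundedDual`, as a named predicate). [cite: KaniewskiLeeDewolf2015, Def. 7] -/
@[cite "KaniewskiLeeDewolf2015" "Def. 7"]
structure CubeSOS (T : ℕ) (g : (Fin N → Bool) → ℝ) : Prop where
  /-- an SOS certificate: finitely many polynomials of total degree `≤ T` whose squares sum to `g` on the cube -/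
  out : ∃ (m : ℕ) (q : Fin m → MvPolynomial (Fin N) ℝ),
    (∀ j, (q j).totalDegree ≤ T) ∧ ∀ x, g x = ∑ j, evalBool (q j) x ^ 2

namespace CubeSOS

variable {T T' : ℕ} {f g : (Fin N → Bool) → ℝ}

/-- Monotonicity in the degree. [folklore] -/
theorem mono (hT : T ≤ T') (h : CubeSOS T g) : CubeSOS T' g := by
  obtain ⟨m, q, hd, hv⟩ := h
  exact ⟨m, q, fun j => (hd j).trans hT, hv⟩

/-- Extensionality in the function. [folklore] -/
theorem congr (h : CubeSOS T g) (hfg : ∀ x, f x = g x) : CubeSOS T f := by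
  obtain ⟨m, q, hd, hv⟩ := h
  exact ⟨m, q, hd, fun x => (hfg x).trans (hv x)⟩

/-- A single square. [folklore] -/
theorem sq (q : MvPolynomial (Fin N) ℝ) (hq : q.totalDegree ≤ T) :
    CubeSOS T (fun x => evalBool q x ^ 2) :=
  ⟨1, fun _ => q, fun _ => hq, fun x => by simp⟩

/-- The zero function. [folklore] -/
theorem zero : CubeSOS T (fun _ : Fin N → Bool => (0 : ℝ)) :=
  ⟨0, Fin.elim0, fun j => Fin.elim0 j, fun x => by simp⟩

/-- A nonnegative constant (`c = (√c)²`, degree `0`). [folklore] -/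
theorem const {c : ℝ} (hc : 0 ≤ c) : CubeSOS T (fun _ : Fin N → Bool => c) := by
  refine ⟨1, fun _ => C (Real.sqrt c), fun _ => ?_, fun x => ?_⟩
  · rw [totalDegree_C]; exact Nat.zero_le _
  · simp [evalBool, Real.sq_sqrt hc]

/-- Closed under addition. [folklore] -/
theorem add (hf : CubeSOS T f) (hg : CubeSOS T g) : CubeSOS T (fun x => f x + g x) := by
  obtain ⟨m₁, q₁, hd₁, hv₁⟩ := hf
  obtain ⟨m₂, q₂, hd₂, hv₂⟩ := hg
  refine ⟨m₁ + m₂, Fin.addCases q₁ q₂, fun j => ?_, fun x => ?_⟩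
  · refine Fin.addCases (fun i => ?_) (fun i => ?_) j
    · simpa using hd₁ i
    · simpa using hd₂ i
  · rw [Fin.sum_univ_add]
    simp only [Fin.addCases_left, Fin.addCases_right, hv₁ x, hv₂ x]

/-- Closed under nonnegative scaling. [folklore] -/
theorem smul {t : ℝ} (ht : 0 ≤ t) (hf : CubeSOS T f) : CubeSOS T (fun x => t * f x) := by
  obtain ⟨m, q, hd, hv⟩ := hf
  refine ⟨m, fun j => C (Real.sqrt t) * q j, fun j => ?_, fun x => ?_⟩
  · refine (totalDegree_mul _ _).trans ?_
    rw [totalDegree_C, zero_add]; exact hd j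
  · beta_reduce
    rw [hv x, Finset.mul_sum]
    refine Finset.sum_congr rfl fun j _ => ?_
    unfold evalBool
    rw [map_mul, eval_C, mul_pow, Real.sq_sqrt ht]

/-- Closed under finite sums. [folklore] -/
theorem sum {ι : Type*} (s : Finset ι) (F : ι → (Fin N → Bool) → ℝ)
    (h : ∀ i ∈ s, CubeSOS T (F i)) : CubeSOS T (fun x => ∑ i ∈ s, F i x) := by
  classical
  induction s using Finset.induction_on with
  | empty => exact zero.congr fun x => by simp
  | insert a s ha ih =>
    have h1 : CubeSOS T (F a) := h a (Finset.mem_insert_self a s)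
    have h2 : CubeSOS T (fun x => ∑ i ∈ s, F i x) := ih fun i hi => h i (Finset.mem_insert_of_mem hi)
    exact (h1.add h2).congr fun x => by rw [Finset.sum_insert ha]

/-- **Closed under products, degrees adding**: `(Σ_j a_j²)(Σ_k b_k²) = Σ_{j,k} (a_j b_k)²`.
[folklore] -/
theorem mul (hf : CubeSOS T f) (hg : CubeSOS T' g) : CubeSOS (T + T') (fun x => f x * g x) := by
  obtain ⟨m₁, q₁, hd₁, hv₁⟩ := hf
  obtain ⟨m₂, q₂, hd₂, hv₂⟩ := hg
  refine ⟨m₁ * m₂, fun t => q₁ (finProdFinEquiv.symm t).1 * q₂ (finProdFinEquiv.symm t).2,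
    fun t => ?_, fun x => ?_⟩
  · exact (totalDegree_mul _ _).trans (Nat.add_le_add (hd₁ _) (hd₂ _))
  · beta_reduce
    rw [hv₁ x, hv₂ x, Fintype.sum_mul_sum, ← Fintype.sum_prod_type']
    refine Fintype.sum_equiv finProdFinEquiv _ _ fun jk => ?_
    simp only [Equiv.symm_apply_apply, evalBool, map_mul, mul_pow]

/-- Closed under finite products, degrees adding. [folklore] -/
theorem prod {ι : Type*} (s : Finset ι) (F : ι → (Fin N → Bool) → ℝ) (d : ι → ℕ)
    (h : ∀ i ∈ s, CubeSOS (d i) (F i)) : CubeSOS (∑ i ∈ s, d i) (fun x => ∏ i ∈ s, F i x) := by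
  classical
  induction s using Finset.induction_on with
  | empty => exact (const zero_le_one).congr fun x => by simp
  | insert a s ha ih =>
    have h1 : CubeSOS (d a) (F a) := h a (Finset.mem_insert_self a s)
    have h2 : CubeSOS (∑ i ∈ s, d i) (fun x => ∏ i ∈ s, F i x) :=
      ih fun i hi => h i (Finset.mem_insert_of_mem hi)
    refine ((h1.mul h2).congr fun x => by rw [Finset.prod_insert ha]).mono ?_
    rw [Finset.sum_insert ha]

/-- Renaming variables (`x ↦ x ∘ φ`) preserves cube SOS certificates. [folklore] -/
theorem rename {N' : ℕ} (φ : Fin N → Fin N') (hf : CubeSOS T f) :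
    CubeSOS T (fun y : Fin N' → Bool => f (y ∘ φ)) := by
  obtain ⟨m, q, hd, hv⟩ := hf
  refine ⟨m, fun j => MvPolynomial.rename φ (q j), fun j => (totalDegree_rename_le _ _).trans (hd j),
    fun y => ?_⟩
  beta_reduce
  rw [hv (y ∘ φ)]
  refine Finset.sum_congr rfl fun j _ => ?_
  unfold evalBool
  rw [eval_rename]
  rfl

end CubeSOS

/-- `p ∈ K_T` iff `p` and `1 - p` carry cube SOS certificates of degree `≤ T` (the definition, with the
two families padded to a common index set). [cite: KaniewskiLeeDewolf2015, Def. 7] -/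
theorem pseudoBounded_iff_cubeSOS (T : ℕ) (p : MvPolynomial (Fin N) ℝ) :
    PseudoBounded T p ↔ CubeSOS T (evalBool p) ∧ CubeSOS T (fun x => 1 - evalBool p x) := by
  constructor
  · rintro ⟨m, q, r, hd, hv⟩
    exact ⟨⟨m, q, fun j => (hd j).1, fun x => (hv x).1⟩, ⟨m, r, fun j => (hd j).2, fun x => (hv x).2⟩⟩
  · rintro ⟨⟨m₁, q, hdq, hvq⟩, ⟨m₂, r, hdr, hvr⟩⟩
    refine ⟨m₁ + m₂, Fin.addCases q (fun _ => 0), Fin.addCases (fun _ => 0) r, fun j => ?_, fun x => ?_⟩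
    · refine Fin.addCases (fun i => ?_) (fun i => ?_) j
      · simpa using hdq i
      · simpa using hdr i
    · refine ⟨?_, ?_⟩
      · rw [Fin.sum_univ_add]
        simp only [Fin.addCases_left, Fin.addCases_right]
        show evalBool p x = _
        rw [hvq x]
        simp [evalBool]
      · rw [Fin.sum_univ_add]
        simp only [Fin.addCases_left, Fin.addCases_right]
        show 1 - evalBool p x = _
        have h2 := hvr x
        beta_reduce at h2
        rw [h2]
        simp [evalBool]

namespace PseudoBounded

variable {T T' : ℕ} {p p' : MvPolynomial (Fin N) ℝ}

/-- **`K` is closed under products, orders adding** (`K_T · K_{T'} ⊆ K_{T+T'}`): `p p' = Σ (q_j q'_k)²`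
and `1 - p p' = (1 - p) + p (1 - p')` on the cube. (Quantum reading: run the two algorithms one after
the other and AND the outcomes.) [folklore] -/
theorem mul (h : PseudoBounded T p) (h' : PseudoBounded T' p') : PseudoBounded (T + T') (p * p') := by
  rw [pseudoBounded_iff_cubeSOS] at h h' ⊢
  obtain ⟨hq, hr⟩ := h
  obtain ⟨hq', hr'⟩ := h'
  refine ⟨(hq.mul hq').congr fun x => ?_, ((hr.mono (Nat.le_add_right T T')).add (hq.mul hr')).congr
    fun x => ?_⟩
  · unfold evalBool; rw [map_mul]
  · unfold evalBool; rw [map_mul]; ring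


end PseudoBounded
end Summit.QuantumAdvantage.QuantumAdvantage.Theorems.SosSandwich
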